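import Summits.QuantumFields.YangMills.Theorems.FlatTubeReductionDiagonalMomentPointwise
import Summits.QuantumFields.YangMills.Theorems.FlatTubeReductionAmplitudeBootstrap
import HarnessLib

/-!
# Gauge amplitudes on the colour-pinned kinetic core: the kinetic cross weight `β·Σ_e ‖g⃗_y‖‖M⃗_e‖` is a POLYNOMIAL of degree one in the Gaussian levels
# `N = β·kinDefect`, `N_v = β‖v̂‖²`, `N_v' = β‖v̂'‖²` (plus `βε²` for the FP window), and the cubic/quartic fibre junk in polynomial form
# (route `FlatTubeReduction`, crux K1 `NearFlatRatioLaw` stmt-QuantumFields-24720; seat `ym-line-ftr-p1` g13; rate twin «ratepack-v3 / frozen fibres»; R2b1 RECORD rung — no summit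
# statement is proved here)

WHY (memo `Cruxes/NearFlatRatioLaw/Lines/ratepack-v3-frozen-g12.md` §§5.11, 6).  The moment machine (`…ReferenceMoments.reference_moment_le`) integrates weights bounded by
polynomials in the kinetic level; the pointwise bounds `E₁`, `E₂'` of `…DiagonalMomentPointwise` / `…DiagonalPhaseSecondOrder` contain the gauge amplitudes `‖g⃗_y‖` and the link
quaternions `‖M⃗_e‖`, which are NOT bounded by the level globally — only on the core, through jumps (lane A `norm_edgeDefect_ge`) and colour pinning (`norm_su2Quat_sub_one_le_of_jumps`).
A SUP over the core would cost `β·amp² ≍ β^{1/6}` (fatal); the POLYNOMIAL form costs `O(1)` in the Gaussian moments: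
* `norm_su2Quat_mul_sub_one_le` — `‖q(ab) − 1‖ ≤ ‖q(a) − 1‖ + ‖q(b) − 1‖` (and `‖q(a⁻¹) − 1‖ = ‖q(a) − 1‖`, tree `TwistedTraceScaling.Negative.R45.norm_su2Quat_inv_sub_one`, re-derived inline);
* ★ `amp_le_on_core` — on `{3L(√kin + 5√2‖v̂‖ + √2‖v̂'‖) < 1} ∩ {colourMean g ∈ fpBall ε}`: `‖q(g_y) − 1‖ ≤ 9L(√kin + 5√2‖v̂‖ + √2‖v̂'‖) + ε` for every site;
* ★ `norm_vecPart_linkM_le` — `‖M⃗_e‖ ≤ √2‖v̂'‖ + ‖q(g_x) − 1‖ + √2‖v̂‖`;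
* ★★ `kineticCross_le_levels` — `β·Σ_e ‖g⃗_y‖‖M⃗_e‖ ≤ |E|·(486L²·N + 24302L²·N_v + 974L²·N_v' + 6βε²)`;
* `cubic_le_levels`, `quartic_le_levels` — `β(‖v̂‖+‖v̂'‖)³ ≤ β^{-1/2}·(2S + 4S²)`, `β(‖v̂‖+‖v̂'‖)⁴ ≤ β⁻¹·4S²`, `S = N_v + N_v'` (no fractional powers downstream).
HONEST FRAMING: quaternion/real-inequality bookkeeping; femto rung R2b1 (RECORD label); not infinite volume, not a gap, not Clay.  No defs, no named facts, no `sorry`.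
-/

set_option autoImplicit false

noncomputable section

open MeasureTheory Filter Topology Real
open scoped BigOperators Matrix
open Literature.MathematicalPhysics.QuantumFieldTheory
open Literature.MathematicalPhysics.QuantumLattice

namespace Summit.QuantumFields.YangMills.Theorems.FemtoTransferGap.RateTube

open Summit.QuantumFields.YangMills.Theorems.FemtoTransferGap
open Summit.QuantumFields.YangMills.Theorems.FemtoTransferGap.TwoLattice
open Summit.QuantumFields.YangMills.Theorems.FemtoTransferGap.TwoLattice.ConstTube
open Summit.QuantumFields.YangMills.Theorems.FemtoTransferGap.TwoLattice.Avg
open Summit.QuantumFields.YangMills.Theorems.FemtoTransferGap.TwoLattice.Cov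
open Summit.QuantumFields.YangMills.Theorems.FemtoTransferGap.TwoLattice.Stiff (LinkSpace)

variable {L : ℕ} [NeZero L]

/-! ## §1 Quaternion norms of products -/

omit [NeZero L] in
/-- `‖q(ab) − 1‖ ≤ ‖q(a) − 1‖ + ‖q(b) − 1‖` (unit quaternions). [folklore] -/
theorem norm_su2Quat_mul_sub_one_le (a b : SU2) : ‖su2Quat (a * b) - 1‖ ≤ ‖su2Quat a - 1‖ + ‖su2Quat b - 1‖ := by
  have hmul := @Literature.MathematicalPhysics.QuantumFieldTheory.Balaban1983to89.T4HaarSU2Translate.su2Quat_mul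
  have e : su2Quat (a * b) - 1 = su2Quat a * (su2Quat b - 1) + (su2Quat a - 1) := by rw [hmul, mul_sub, mul_one]; abel
  rw [e]
  calc ‖su2Quat a * (su2Quat b - 1) + (su2Quat a - 1)‖ ≤ ‖su2Quat a * (su2Quat b - 1)‖ + ‖su2Quat a - 1‖ := norm_add_le _ _
    _ = ‖su2Quat b - 1‖ + ‖su2Quat a - 1‖ := by rw [norm_mul, norm_su2Quat, one_mul]
    _ = ‖su2Quat a - 1‖ + ‖su2Quat b - 1‖ := add_comm _ _

/-! ## §2 ★ Amplitudes on the pinned core -/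

/-- ★ **Gauge amplitude on the pinned kinetic core** (one pass of the bootstrap from the trivial amplitude `2`): for `v, v'` on the cap, `colourMean g ∈ fpBall ε` and
`3L(√kin + 5√2‖v̂‖ + √2‖v̂'‖) < 1` (`kin = kinDefect (orthoTube 1 v) (orthoTube 1 v') g`): every `‖q(g_y) − 1‖ ≤ 9L(√kin + 5√2‖v̂‖ + √2‖v̂'‖) + ε`. [folklore] -/
theorem amp_le_on_core {v v' : Edge 3 L → Fin 3 → ℝ} (hv1 : ∀ e, ∑ a, v e a ^ 2 ≤ 1) (hv'1 : ∀ e, ∑ a, v' e a ^ 2 ≤ 1) {g : Site 3 L → SU2} {ε : ℝ}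
    (hW : colourMean L g ∈ fpBall ε)
    (hsmall : 3 * L * (Real.sqrt (kinDefect L (orthoTube L 1 v) (orthoTube L 1 v') g) + 5 * Real.sqrt 2 * ‖linkEmbed L v‖ + Real.sqrt 2 * ‖linkEmbed L v'‖) < 1)
    (y : Site 3 L) :
    ‖su2Quat (g y) - 1‖ ≤ 9 * L * (Real.sqrt (kinDefect L (orthoTube L 1 v) (orthoTube L 1 v') g) + 5 * Real.sqrt 2 * ‖linkEmbed L v‖ + Real.sqrt 2 * ‖linkEmbed L v'‖) + ε := by
  have ha : ∀ e, ‖su2Quat (orthoTube L 1 v e) - 1‖ ≤ Real.sqrt 2 * ‖linkEmbed L v‖ := fun e => by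
    have h := norm_su2Quat_orthoTube_sub_one_le (1 : GaugeConfig 3 1 SU2) hv1 e
    rw [Pi.one_apply, su2Quat_one, sub_self, norm_zero, add_zero] at h; exact h
  have hb : ∀ e, ‖su2Quat (orthoTube L 1 v e) - su2Quat (orthoTube L 1 v' e)‖ ≤ Real.sqrt 2 * ‖linkEmbed L v‖ + Real.sqrt 2 * ‖linkEmbed L v'‖ := fun e => by
    have h := norm_su2Quat_orthoTube_sub_orthoTube_le (1 : GaugeConfig 3 1 SU2) 1 hv1 hv'1 e
    rw [sub_self, norm_zero, add_zero] at h; exact h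
  have hA0 : ∀ x, ‖su2Quat (g x) - 1‖ ≤ 2 := fun x => (norm_sub_le _ _).trans (by rw [norm_su2Quat, norm_one]; norm_num)
  have key : Real.sqrt (kinDefect L (orthoTube L 1 v) (orthoTube L 1 v') g) + 2 * (Real.sqrt 2 * ‖linkEmbed L v‖) * 2 +
      (Real.sqrt 2 * ‖linkEmbed L v‖ + Real.sqrt 2 * ‖linkEmbed L v'‖) =
      Real.sqrt (kinDefect L (orthoTube L 1 v) (orthoTube L 1 v') g) + 5 * Real.sqrt 2 * ‖linkEmbed L v‖ + Real.sqrt 2 * ‖linkEmbed L v'‖ := by ring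
  have hs : 3 * L * (Real.sqrt (kinDefect L (orthoTube L 1 v) (orthoTube L 1 v') g) + 2 * (Real.sqrt 2 * ‖linkEmbed L v‖) * 2 +
      (Real.sqrt 2 * ‖linkEmbed L v‖ + Real.sqrt 2 * ‖linkEmbed L v'‖)) < 1 := by rw [key]; exact hsmall
  have h := amp_step (orthoTube L 1 v) (orthoTube L 1 v') ha hb le_rfl hA0 hs hW y
  rw [key] at h; exact h

/-- ★ **The link quaternion of the diagonal kinetic term**: `‖vecPart(M_e)‖ ≤ √2‖v̂'‖ + ‖q(g_x) − 1‖ + √2‖v̂‖` (`M_e = chart(v'_e)⁻¹ g_x⁻¹ chart(v_e)`). [folklore] -/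
theorem norm_vecPart_linkM_le {v v' : Edge 3 L → Fin 3 → ℝ} (hv1 : ∀ e, ∑ a, v e a ^ 2 ≤ 1) (hv'1 : ∀ e, ∑ a, v' e a ^ 2 ≤ 1) (g : Site 3 L → SU2) (e : Edge 3 L) :
    ‖vecPart (linkM L v v' g e)‖ ≤ Real.sqrt 2 * ‖linkEmbed L v'‖ + ‖su2Quat (g e.1) - 1‖ + Real.sqrt 2 * ‖linkEmbed L v‖ := by
  have hv : ‖su2Quat (chartSU2 (v e)) - 1‖ ≤ Real.sqrt 2 * ‖linkEmbed L v‖ := by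
    have h := norm_su2Quat_orthoTube_sub_one_le (L := L) (1 : GaugeConfig 3 1 SU2) hv1 e
    rw [Pi.one_apply, su2Quat_one, sub_self, norm_zero, add_zero, orthoTube_apply, Pi.one_apply, mul_one] at h; exact h
  have hv' : ‖su2Quat (chartSU2 (v' e)) - 1‖ ≤ Real.sqrt 2 * ‖linkEmbed L v'‖ := by
    have h := norm_su2Quat_orthoTube_sub_one_le (L := L) (1 : GaugeConfig 3 1 SU2) hv'1 e
    rw [Pi.one_apply, su2Quat_one, sub_self, norm_zero, add_zero, orthoTube_apply, Pi.one_apply, mul_one] at h; exact h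
  have hinv : ∀ a : SU2, ‖su2Quat a⁻¹ - 1‖ = ‖su2Quat a - 1‖ := fun a => by
    have h := norm_su2Quat_mul_inv_sub_one (1 : SU2) a
    rw [one_mul, su2Quat_one] at h
    rw [h, norm_sub_rev]
  unfold linkM
  calc ‖vecPart ((chartSU2 (v' e))⁻¹ * (g e.1)⁻¹ * chartSU2 (v e))‖ ≤ ‖su2Quat ((chartSU2 (v' e))⁻¹ * (g e.1)⁻¹ * chartSU2 (v e)) - 1‖ := norm_vecPart_le_norm_sub_one _
    _ ≤ ‖su2Quat ((chartSU2 (v' e))⁻¹ * (g e.1)⁻¹) - 1‖ + ‖su2Quat (chartSU2 (v e)) - 1‖ := norm_su2Quat_mul_sub_one_le _ _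
    _ ≤ ‖su2Quat (chartSU2 (v' e))⁻¹ - 1‖ + ‖su2Quat (g e.1)⁻¹ - 1‖ + ‖su2Quat (chartSU2 (v e)) - 1‖ := by
        gcongr; exact norm_su2Quat_mul_sub_one_le _ _
    _ = ‖su2Quat (chartSU2 (v' e)) - 1‖ + ‖su2Quat (g e.1) - 1‖ + ‖su2Quat (chartSU2 (v e)) - 1‖ := by
        rw [hinv, hinv]
    _ ≤ Real.sqrt 2 * ‖linkEmbed L v'‖ + ‖su2Quat (g e.1) - 1‖ + Real.sqrt 2 * ‖linkEmbed L v‖ := by gcongr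

/-! ## §3 ★★ The kinetic cross weight is linear in the levels -/

set_option maxHeartbeats 800000 in
/-- ★★ **The kinetic cross weight on the pinned core, in the Gaussian levels**: under the hypotheses of `amp_le_on_core`, with `N = β·kin`, `N_v = β‖v̂‖²`, `N_v' = β‖v̂'‖²` (`β ≥ 0`):
`β·Σ_e ‖vecPart(g_{x+k})‖·‖vecPart(M_e)‖ ≤ |E|·(486L²·N + 24302L²·N_v + 974L²·N_v' + 6βε²)`. [folklore] -/
theorem kineticCross_le_levels {β : ℝ} (hβ : 0 ≤ β) {v v' : Edge 3 L → Fin 3 → ℝ} (hv1 : ∀ e, ∑ a, v e a ^ 2 ≤ 1) (hv'1 : ∀ e, ∑ a, v' e a ^ 2 ≤ 1)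
    {g : Site 3 L → SU2} {ε : ℝ} (hW : colourMean L g ∈ fpBall ε)
    (hsmall : 3 * L * (Real.sqrt (kinDefect L (orthoTube L 1 v) (orthoTube L 1 v') g) + 5 * Real.sqrt 2 * ‖linkEmbed L v‖ + Real.sqrt 2 * ‖linkEmbed L v'‖) < 1) :
    β * ∑ e : Edge 3 L, ‖vecPart (g (e.1.shift e.2))‖ * ‖vecPart (linkM L v v' g e)‖ ≤
      (Fintype.card (Edge 3 L) : ℝ) * (486 * (L : ℝ) ^ 2 * (β * kinDefect L (orthoTube L 1 v) (orthoTube L 1 v') g) + 24302 * (L : ℝ) ^ 2 * (β * ‖linkEmbed L v‖ ^ 2) +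
        974 * (L : ℝ) ^ 2 * (β * ‖linkEmbed L v'‖ ^ 2) + 6 * (β * ε ^ 2)) := by
  set kin := kinDefect L (orthoTube L 1 v) (orthoTube L 1 v') g with hkin
  set r := ‖linkEmbed L v‖ with hr
  set r' := ‖linkEmbed L v'‖ with hr'
  have hkin0 : 0 ≤ kin := kinDefect_nonneg _ _ _
  have hr0 : 0 ≤ r := norm_nonneg _
  have hr'0 : 0 ≤ r' := norm_nonneg _
  have hL1 : (1 : ℝ) ≤ L := by exact_mod_cast NeZero.one_le
  have h2 : Real.sqrt 2 ^ 2 = 2 := Real.sq_sqrt (by norm_num)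
  have hs0 : 0 ≤ Real.sqrt 2 := Real.sqrt_nonneg _
  have hsk : Real.sqrt kin ^ 2 = kin := Real.sq_sqrt hkin0
  have hsk0 : 0 ≤ Real.sqrt kin := Real.sqrt_nonneg _
  set A : ℝ := 9 * L * (Real.sqrt kin + 5 * Real.sqrt 2 * r + Real.sqrt 2 * r') + ε with hA
  have hamp : ∀ y, ‖su2Quat (g y) - 1‖ ≤ A := fun y => amp_le_on_core hv1 hv'1 hW hsmall y
  have hA0 : 0 ≤ A := (norm_nonneg _).trans (hamp 0)
  -- per edge
  have hedge : ∀ e : Edge 3 L, ‖vecPart (g (e.1.shift e.2))‖ * ‖vecPart (linkM L v v' g e)‖ ≤ A * (A + Real.sqrt 2 * (r + r')) := fun e => by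
    have h1 : ‖vecPart (g (e.1.shift e.2))‖ ≤ A := (norm_vecPart_le_norm_sub_one _).trans (hamp _)
    have h2 : ‖vecPart (linkM L v v' g e)‖ ≤ A + Real.sqrt 2 * (r + r') := by
      have h := norm_vecPart_linkM_le hv1 hv'1 g e
      have h' := hamp e.1
      rw [← hr, ← hr'] at h; linarith
    exact mul_le_mul h1 h2 (norm_nonneg _) hA0
  have hsum : ∑ e : Edge 3 L, ‖vecPart (g (e.1.shift e.2))‖ * ‖vecPart (linkM L v v' g e)‖ ≤ (Fintype.card (Edge 3 L) : ℝ) * (A * (A + Real.sqrt 2 * (r + r'))) := by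
    calc ∑ e : Edge 3 L, ‖vecPart (g (e.1.shift e.2))‖ * ‖vecPart (linkM L v v' g e)‖ ≤ ∑ _e : Edge 3 L, A * (A + Real.sqrt 2 * (r + r')) := Finset.sum_le_sum fun e _ => hedge e
      _ = (Fintype.card (Edge 3 L) : ℝ) * (A * (A + Real.sqrt 2 * (r + r'))) := by rw [Finset.sum_const, Finset.card_univ, nsmul_eq_mul]
  -- `A(A + s) ≤ (3/2)A² + s²/2`, `A² ≤ 4(81L²kin + 4050L²r² + 162L²r'² + ε²)`, `s² ≤ 4(r² + r'²)`
  have hAA : A * (A + Real.sqrt 2 * (r + r')) ≤ 486 * (L : ℝ) ^ 2 * kin + 24302 * (L : ℝ) ^ 2 * r ^ 2 + 974 * (L : ℝ) ^ 2 * r' ^ 2 + 6 * ε ^ 2 := by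
    have hsq : A ^ 2 ≤ 4 * ((9 * L * Real.sqrt kin) ^ 2 + (9 * L * (5 * Real.sqrt 2 * r)) ^ 2 + (9 * L * (Real.sqrt 2 * r')) ^ 2 + ε ^ 2) := by
      have e : A = 9 * L * Real.sqrt kin + 9 * L * (5 * Real.sqrt 2 * r) + 9 * L * (Real.sqrt 2 * r') + ε := by rw [hA]; ring
      rw [e]
      nlinarith [sq_nonneg (9 * L * Real.sqrt kin - 9 * L * (5 * Real.sqrt 2 * r)), sq_nonneg (9 * L * Real.sqrt kin - 9 * L * (Real.sqrt 2 * r')),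
        sq_nonneg (9 * L * Real.sqrt kin - ε), sq_nonneg (9 * L * (5 * Real.sqrt 2 * r) - 9 * L * (Real.sqrt 2 * r')),
        sq_nonneg (9 * L * (5 * Real.sqrt 2 * r) - ε), sq_nonneg (9 * L * (Real.sqrt 2 * r') - ε)]
    have hsq' : A ^ 2 ≤ 4 * (81 * (L : ℝ) ^ 2 * kin + 4050 * (L : ℝ) ^ 2 * r ^ 2 + 162 * (L : ℝ) ^ 2 * r' ^ 2 + ε ^ 2) := by
      have e1 : (9 * L * Real.sqrt kin) ^ 2 = 81 * (L : ℝ) ^ 2 * kin := by rw [mul_pow, mul_pow, hsk]; ring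
      have e2 : (9 * L * (5 * Real.sqrt 2 * r)) ^ 2 = 4050 * (L : ℝ) ^ 2 * r ^ 2 := by
        have : (9 * L * (5 * Real.sqrt 2 * r)) ^ 2 = 2025 * (L : ℝ) ^ 2 * Real.sqrt 2 ^ 2 * r ^ 2 := by ring
        rw [this, h2]; ring
      have e3 : (9 * L * (Real.sqrt 2 * r')) ^ 2 = 162 * (L : ℝ) ^ 2 * r' ^ 2 := by
        have : (9 * L * (Real.sqrt 2 * r')) ^ 2 = 81 * (L : ℝ) ^ 2 * Real.sqrt 2 ^ 2 * r' ^ 2 := by ring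
        rw [this, h2]; ring
      rw [e1, e2, e3] at hsq; exact hsq
    have hss : (Real.sqrt 2 * (r + r')) ^ 2 ≤ 4 * (r ^ 2 + r' ^ 2) := by
      have : (Real.sqrt 2 * (r + r')) ^ 2 = 2 * (r + r') ^ 2 := by rw [mul_pow, h2]
      rw [this]; nlinarith [sq_nonneg (r - r')]
    have hprod : A * (A + Real.sqrt 2 * (r + r')) ≤ 3 / 2 * A ^ 2 + (Real.sqrt 2 * (r + r')) ^ 2 / 2 := by
      nlinarith [sq_nonneg (A - Real.sqrt 2 * (r + r'))]
    have hL2 : (1 : ℝ) ≤ (L : ℝ) ^ 2 := one_le_pow₀ hL1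
    nlinarith [hsq', hss, hprod, mul_nonneg (sub_nonneg.mpr hL2) (sq_nonneg r), mul_nonneg (sub_nonneg.mpr hL2) (sq_nonneg r')]
  have hcard : (0 : ℝ) ≤ Fintype.card (Edge 3 L) := Nat.cast_nonneg _
  calc β * ∑ e : Edge 3 L, ‖vecPart (g (e.1.shift e.2))‖ * ‖vecPart (linkM L v v' g e)‖ ≤ β * ((Fintype.card (Edge 3 L) : ℝ) * (A * (A + Real.sqrt 2 * (r + r')))) :=
        mul_le_mul_of_nonneg_left hsum hβ
    _ ≤ β * ((Fintype.card (Edge 3 L) : ℝ) * (486 * (L : ℝ) ^ 2 * kin + 24302 * (L : ℝ) ^ 2 * r ^ 2 + 974 * (L : ℝ) ^ 2 * r' ^ 2 + 6 * ε ^ 2)) :=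
        mul_le_mul_of_nonneg_left (mul_le_mul_of_nonneg_left hAA hcard) hβ
    _ = (Fintype.card (Edge 3 L) : ℝ) * (486 * (L : ℝ) ^ 2 * (β * kin) + 24302 * (L : ℝ) ^ 2 * (β * r ^ 2) + 974 * (L : ℝ) ^ 2 * (β * r' ^ 2) + 6 * (β * ε ^ 2)) := by
        ring

/-! ## §4 Cubic and quartic fibre junk in polynomial form -/

omit [NeZero L] in
/-- `β·τ³ ≤ β^{-1/2}·(βτ² + (βτ²)²)` for `τ ≥ 0`, `β > 0` (`y³ ≤ y² + y⁴` with `y = √β·τ`). [folklore] -/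
theorem cubic_le_levels {β τ : ℝ} (hβ : 0 < β) (hτ : 0 ≤ τ) : β * τ ^ 3 ≤ (Real.sqrt β)⁻¹ * (β * τ ^ 2 + (β * τ ^ 2) ^ 2) := by
  have hsβ : 0 < Real.sqrt β := Real.sqrt_pos.mpr hβ
  have hsq : Real.sqrt β ^ 2 = β := Real.sq_sqrt hβ.le
  set y := Real.sqrt β * τ with hy
  have hy0 : 0 ≤ y := mul_nonneg hsβ.le hτ
  have hy3 : y ^ 3 ≤ y ^ 2 + y ^ 4 := by nlinarith [sq_nonneg (y - 1), sq_nonneg y, mul_nonneg hy0 (sq_nonneg (y - 1))]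
  have e1 : β * τ ^ 3 = (Real.sqrt β)⁻¹ * y ^ 3 := by
    rw [hy, mul_pow, show Real.sqrt β ^ 3 = Real.sqrt β ^ 2 * Real.sqrt β by ring, hsq]
    field_simp
  have e2 : β * τ ^ 2 = y ^ 2 := by rw [hy, mul_pow, hsq]
  rw [e1, e2]
  have e3 : (y ^ 2) ^ 2 = y ^ 4 := by ring
  rw [e3]
  exact mul_le_mul_of_nonneg_left hy3 (inv_nonneg.mpr hsβ.le)

omit [NeZero L] in
/-- `β·τ⁴ = β⁻¹·(βτ²)²` (`β ≠ 0`). [folklore] -/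
theorem quartic_eq_levels {β τ : ℝ} (hβ : β ≠ 0) : β * τ ^ 4 = β⁻¹ * (β * τ ^ 2) ^ 2 := by
  rw [eq_comm, inv_mul_eq_iff_eq_mul₀ hβ]; ring

omit [NeZero L] in
/-- The sum of two fibre radii in the levels: with `τ = r + r'`, `βτ² ≤ 2(βr² + βr'²)`. [folklore] -/
theorem sq_sum_le_levels (β r r' : ℝ) (hβ : 0 ≤ β) : β * (r + r') ^ 2 ≤ 2 * (β * r ^ 2 + β * r' ^ 2) := by
  nlinarith [sq_nonneg (r - r'), hβ]

end Summit.QuantumFields.YangMills.Theorems.FemtoTransferGap.RateTube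

end
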